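import Literature.Topology.FourManifolds.CorkDecompositionSplittingProof
import Literature.Topology.FourManifolds.SeamAdaptedWitnesses
import HarnessLib

/-!
# Discharged fact: Matveyev's fig. 2 — a connected sum taken on the seams of two boundary gluings is
# the gluing of the boundary connected sums (Matveyev 1996, proof of the Theorem, part 2)

`Literature.Topology.FourManifolds.exists_isConnectedSum_isBoundaryGluing_of_halfDiscs`
(`Topology/FourManifolds/CorkDecompositionSplitting`: `(A ∪_φ B) # (C ∪_χ D)` taken on the seams is
`(A ♮ C) ∪_{∂A # ∂C} (B ♮ D)`) was reduced in the tree to the existence of seam-adapted gluing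
witnesses (`exists_seamAdaptedWitnesses`, used at two universe pairs) by
`exists_isConnectedSum_isBoundaryGluing_of_halfDiscs_of_seamAdapted`
(`CorkDecompositionSplittingProof`); the witnesses are a theorem of the tree
(`exists_seamAdaptedWitnesses_holds`, `SeamAdaptedWitnesses`, at all universes).  One-line
application at the universes `(u, 0)` of the reduction; no statement is changed; no definition, no new
named fact (D-0026).

## References

* R. Matveyev, *A decomposition of smooth simply-connected h-cobordant 4-manifolds*, J. Differential
  Geom. 44 (1996) 571–582, proof of the Theorem, part 2, fig. 2 (arXiv p. 3). [Matveyev1996]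
-/

noncomputable section

namespace Literature.Topology.FourManifolds

universe u

/-- **Matveyev 1996, fig. 2 — the named fact `exists_isConnectedSum_isBoundaryGluing_of_halfDiscs`
holds (universes `(u, 0)`)**: `exists_isConnectedSum_isBoundaryGluing_of_halfDiscs_of_seamAdapted`
applied twice to `exists_seamAdaptedWitnesses_holds`.
[cite: Matveyev1996, proof of Theorem part 2, fig. 2 (arXiv p. 3)] -/
theorem exists_isConnectedSum_isBoundaryGluing_of_halfDiscs_holds :
    exists_isConnectedSum_isBoundaryGluing_of_halfDiscs.{u, 0} :=
  exists_isConnectedSum_isBoundaryGluing_of_halfDiscs_of_seamAdapted exists_seamAdaptedWitnesses_holds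
    exists_seamAdaptedWitnesses_holds

end Literature.Topology.FourManifolds

end
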